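import Summits.BirchSwinnertonDyer.BirchSwinnertonDyer.Theorems.AlignedTransportAtTwoMainConjectureOfRankZeroBSDAtTwoCubicProCyclicRowN4827
import Summits.BirchSwinnertonDyer.BirchSwinnertonDyer.Theorems.AlignedTransportAtTwoMainConjectureOfRankZeroBSDAtTwoCubicOrderFourRowN4827
import HarnessLib

/-!
# Route `AlignedTransportAtTwo`, crux C2 `MainConjectureOfRankZeroBSDAtTwo` (stmt-BirchSwinnertonDyer-22298):
# `μ₂ = 0`, `λ₂ ≤ 1`, `rank₂ Cl(K_m) ≤ 1 ∀ m` — UNCONDITIONAL — for the cyclotomic `ℤ₂`-extensions of the cubic `2`-torsion field of `⟨1, 1, 0, -24, -57⟩`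
# (`N = 4827`, `t = 3`, the `2`-torsion field of a RANK-ONE curve): att-p3 g46's PRO-CYCLIC DOOR ∘ att-p4 g40's ORDER-FOUR CERTIFICATE

HONEST FRAMING (cell `bsd-f1-sign2`, WIDTH-5 attached prover seat `bsd-line-att-p4` gen 40 on line `birth` of the lead `bsd-line-att-p2`;
`--supports` stmt-BirchSwinnertonDyer-22298, closes nothing; BSD is NOT proved by any of this; the crux C2, its verdict «blocked-on
`Rank1Residual.GreenbergMuConjectureIrreducible`» and every registered stub are untouched).  THEOREMS ONLY (no `def`, no named fact, no instance, no `sorry`).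

WHAT.  att-p3 g46's second pro-cyclic customer (`…CubicProCyclicRowN4827.classGroupPRank_le_one_cubicField_n4827`: `t = 3` by a residue map mod `16`) displays
ONE hypothesis, the class-number bit `he1 : 2 ≤ classNumberPExp κ 1` (`4 ∣ h(ℚ(β,√2))`); this seat's order-four certificate
(`…CubicOrderFourRowN4827.two_le_classNumberPExp_one_cubicField_n4827`: three units of `ℚ(β,√2)` modulo `±` squares, the prime `(q₀, √2 − 3)` above `7` of
order `4`, `31` residue certificates) proves it.  Composing:
* ★★★ `classGroupPRank_le_one_and_mu_lambda_cubicField_n4827` — for `β` ANY root of the `2`-division cubic of `⟨1,1,0,−24,−57⟩` and EVERY cyclotomic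
  `ℤ₂`-extension `κ` of `ℚ(β)` (the cubic field of discriminant `−4827`): `rank₂ Cl(K_m) ≤ 1 ∀ m`, `μ₂(κ) = 0`, `λ₂(κ) ≤ 1` — NO hypothesis;
* ★★ `classicalMuVanishes_cubicField_n4827_unconditional`.
A FIELD theorem (the curve has analytic rank one, so no `MC₂` row of the `r_an = 0` carrier road; what the cell's `μ₂`-census and any rank-one carrier over
`ℚ(β)` consume).  Nothing is closed; BSD is NOT proved.

References: [Washington1997] §13.3 Prop. 13.22–13.23; [Fukuda1994] Thm. 1 (2); [Lang1990] Ch. 13 §4 Lemma 4.1; [NeukirchANT1999] I §7 (7.4); [Cohen1993] §6.5;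
[LMFDB] nf 3.1.4827.1; tree: att-p3 g46 `…CubicProCyclicRowN4827`, att-p4 g40 `…CubicOrderFourRowN4827{Data,Certs,}`.
-/

set_option linter.dupNamespace false
set_option autoImplicit false

noncomputable section

open scoped Classical NumberField nonZeroDivisors IntermediateField

namespace Summit.BirchSwinnertonDyer.BirchSwinnertonDyer.Theorems.AlignedTransportAtTwoCubicOrderFourRowN4827

open NumberField IsDedekindDomain Polynomial WeierstrassCurve IntermediateField CongruenceSubgroup Module
  Literature.NumberTheory.IwasawaTheory Literature.NumberTheory.GaloisRepresentations
  Literature.NumberTheory.EllipticCurves Literature.NumberTheory.EllipticCurves.Greenberg1999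
  Literature.NumberTheory.EllipticCurves.Rank1Residual
  Literature.NumberTheory.NumberFields Literature.NumberTheory.CubicFields
  Summit.BirchSwinnertonDyer.BirchSwinnertonDyer.Theorems.AlignedTransportAtTwoCubicDoorsDeadSubcellClassNumberD
  Summit.BirchSwinnertonDyer.BirchSwinnertonDyer.Theorems.AlignedTransportAtTwoCubicProCyclicRowN4827

/-- ★★★ **`rank₂ Cl(K_m) ≤ 1 ∀ m`, `μ₂ = 0`, `λ₂ ≤ 1` — UNCONDITIONAL — for every cyclotomic `ℤ₂`-extension `κ` of the cubic `2`-torsion field `ℚ(β)` of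
`⟨1,1,0,−24,−57⟩` (discriminant `−4827`)**: att-p3 g46's pro-cyclic door row with its displayed input `2 ≤ classNumberPExp κ 1` discharged by this seat's
order-four certificate. [cite: Washington1997, §13.3 Prop. 13.22–13.23] [cite: Fukuda1994, Thm. 1 (2), p. 264] [cite: NeukirchANT1999, Ch. I §7 Thm. (7.4)]
[cite: LMFDB, number field 3.1.4827.1 (class number 1)] -/
theorem classGroupPRank_le_one_and_mu_lambda_cubicField_n4827 {β : AlgebraicClosure ℚ}
    (hβ : aeval β ((⟨1, 1, 0, -24, -57⟩ : WeierstrassCurve ℤ).baseChange ℚ).twoTorsionPolynomial.toPoly = 0)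
    (κP : ZpExtension ↥(IntermediateField.adjoin ℚ ({β} : Set (AlgebraicClosure ℚ))) 2) (hκP : κP.IsCyclotomic) :
    (∀ m, classGroupPRank κP m ≤ 1) ∧ ClassicalMuVanishes κP ∧ classicalLambda κP ≤ 1 :=
  classGroupPRank_le_one_cubicField_n4827 hβ κP hκP (two_le_classNumberPExp_one_cubicField_n4827 hβ κP hκP)

/-- ★★ **`μ₂(κ) = 0` — UNCONDITIONAL — for every cyclotomic `ℤ₂`-extension `κ` of the cubic field of discriminant `−4827`.**
[cite: Washington1997, §13.3 Prop. 13.23] [cite: LMFDB, number field 3.1.4827.1] -/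
theorem classicalMuVanishes_cubicField_n4827_unconditional {β : AlgebraicClosure ℚ}
    (hβ : aeval β ((⟨1, 1, 0, -24, -57⟩ : WeierstrassCurve ℤ).baseChange ℚ).twoTorsionPolynomial.toPoly = 0)
    (κP : ZpExtension ↥(IntermediateField.adjoin ℚ ({β} : Set (AlgebraicClosure ℚ))) 2) (hκP : κP.IsCyclotomic) : ClassicalMuVanishes κP :=
  (classGroupPRank_le_one_and_mu_lambda_cubicField_n4827 hβ κP hκP).2.1

end Summit.BirchSwinnertonDyer.BirchSwinnertonDyer.Theorems.AlignedTransportAtTwoCubicOrderFourRowN4827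

end
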